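import Mathlib.MeasureTheory.Integral.IntervalIntegral.Periodic
import Summits.AnomalousDissipation.AnomalousDissipation.Theorems.SawtoothPulseCascadeK1LocalisedCascadeZoneMeasure

/-!
# K1loc, line `Spectral` / SeqCone — helper: THE ZONE-JUNK BUDGET `∫_{𝕋^d} (1 − X⁺(x_j) − X⁻(x_j))² ≤ 4Mδ_j/π` (S-C data)

Helper file of the prover lane on the crux `K1LocalisedCascade` (stmt-AnomalousDissipation-19491), route
`SawtoothPulseCascade` (memo v6 addendum §B step 1).  The restart of `…SlotRestart` junks, at every half-slot boundary, the zone
part `(1 − X⁺ − X⁻)(x_j)·g` of the good piece; by the maximum principle its energy is at most `sup|datum|²·∫(1 − X⁺(x_j) − X⁻(x_j))²`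
(`…SlotRestart.junk_scalarL2Sq_le`).  This file bounds that torus integral by the one-dimensional measure of the zone:
* `integral_comp_eval_eq_integral_circle` — `∫_{𝕋^d} G(x_j) dx = ∫_𝕋 G` (the `j`-th coordinate is measure preserving);
* `integral_one_sub_sq_le_measureReal` — for profiles with `0 ≤ X⁺ + X⁻ ≤ 1`:
  `∫_{𝕋^d}(1 − X⁺(x_j) − X⁻(x_j))² ≤ vol{y ∈ (0,1] : X⁺(y) + X⁻(y) < 1}`;
* `measureReal_cutoff_zone_le` / `integral_one_sub_cutoff_sq_le` — for the cascade profile `U_j` and cut-offs whose zone lies in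
  `{|U_j′| < 1 − ε}` with `ε ≥ 2e^{−M²/2}` (`…StripCutoff.abs_lt_of_cutoff_add_lt_one`), the zone has measure `≤ 4Mδ_j/π`
  (`…ZoneMeasure.volume_zone_le'`), hence `∫_{𝕋^d}(1 − X⁺(x_j) − X⁻(x_j))² ≤ 4Mδ_j/π`.
No definitions; no statement about the stub.
[cite: ElgindiLissMattingly2025, §1 (corner strips of the sawtooth shears)] [problem: turb]
-/

-- `Summit.<Summit>.<Problem>`: single-conjunct summit, the duplicate namespace segment is deliberate.
set_option linter.dupNamespace false

noncomputable section

namespace Summit.AnomalousDissipation.AnomalousDissipation.Theorems.SawtoothPulseCascade.K1Flat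

open MeasureTheory Set Filter Topology
open scoped ENNReal
open Literature.Analysis Literature.Analysis.FunctionSpaces Literature.Analysis.FunctionSpaces.Torus
open Literature.Analysis.FluidPDE.SawtoothCascade

variable {d : Type*} [Fintype d]

/-! ## The `j`-th coordinate is measure preserving -/

/-- `∫_{𝕋^d} G(x_j) dx = ∫_𝕋 G(b) db` for continuous `G`. [folklore] -/
theorem integral_comp_eval_eq_integral_circle {G : UnitAddCircle → ℝ} (hG : Continuous G) (j : d) :
    ∫ x : UnitAddTorus d, G (x j) = ∫ b : UnitAddCircle, G b := by
  have hev : MeasurePreserving (fun x : UnitAddTorus d => x j) volume volume :=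
    measurePreserving_eval (fun _ : d => (volume : Measure UnitAddCircle)) j
  rw [← integral_map (measurable_pi_apply j).aemeasurable (by rw [hev.map_eq]; exact hG.aestronglyMeasurable), hev.map_eq]

/-! ## The torus integral of the squared zone weight is at most the measure of the zone -/

/-- **Zone weight versus zone measure.**  For profiles with `0 ≤ X⁺ + X⁻ ≤ 1`:
`∫_{𝕋^d} (1 − X⁺(x_j) − X⁻(x_j))² dx ≤ vol{y ∈ (0,1] : X⁺(y) + X⁻(y) < 1}` (the integrand is `≤ 1` and vanishes off the zone).
[cite: ElgindiLissMattingly2025, §1 (corner strips)] -/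
theorem integral_one_sub_sq_le_measureReal (Xp Xm : ShearProfile) (h0 : ∀ y, 0 ≤ Xp y + Xm y)
    (h1 : ∀ y, Xp y + Xm y ≤ 1) (j : d) :
    ∫ x : UnitAddTorus d, (1 - Xp.onCircle (x j) - Xm.onCircle (x j)) ^ 2 ≤
      volume.real {y : ℝ | y ∈ Ioc (0 : ℝ) 1 ∧ Xp y + Xm y < 1} := by
  set G : UnitAddCircle → ℝ := fun b => (1 - Xp.onCircle b - Xm.onCircle b) ^ 2 with hG_def
  have hG : Continuous G := ((continuous_const.sub Xp.continuous_onCircle).sub Xm.continuous_onCircle).pow 2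
  have h1' : ∫ x : UnitAddTorus d, (1 - Xp.onCircle (x j) - Xm.onCircle (x j)) ^ 2 = ∫ b : UnitAddCircle, G b :=
    integral_comp_eval_eq_integral_circle hG j
  rw [h1', ← UnitAddCircle.integral_preimage 0 G, zero_add]
  -- on `(0,1]` the lift is `(1 − X⁺ − X⁻)²`, which is `≤` the indicator of the zone
  set Z : Set ℝ := {y : ℝ | Xp y + Xm y < 1} with hZ_def
  have hZm : MeasurableSet Z :=
    (isOpen_lt (Xp.continuous.add Xm.continuous) continuous_const).measurableSet
  have hGcoe : ∀ a : ℝ, G (a : UnitAddCircle) = (1 - Xp a - Xm a) ^ 2 := fun a => by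
    simp only [hG_def, ShearProfile.onCircle_coe]
  have hle : ∀ a ∈ Ioc (0 : ℝ) 1, G (a : UnitAddCircle) ≤ Z.indicator 1 a := by
    intro a _
    rw [hGcoe]
    by_cases ha : a ∈ Z
    · rw [indicator_of_mem ha, Pi.one_apply]
      have : Xp a + Xm a < 1 := ha
      nlinarith [h0 a]
    · rw [indicator_of_notMem ha]
      have hge : 1 ≤ Xp a + Xm a := not_lt.mp ha
      have : Xp a + Xm a = 1 := le_antisymm (h1 a) hge
      nlinarith
  have hGc' : Continuous fun a : ℝ => G (a : UnitAddCircle) := hG.comp (AddCircle.continuous_mk' 1)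
  have hint1 : IntegrableOn (fun a : ℝ => G (a : UnitAddCircle)) (Ioc 0 1) volume :=
    (hGc'.integrableOn_Icc (a := 0) (b := 1)).mono_set Ioc_subset_Icc_self
  have hint2 : IntegrableOn (Z.indicator (1 : ℝ → ℝ)) (Ioc 0 1) volume := by
    refine Integrable.indicator ?_ hZm
    exact integrableOn_const (by rw [Real.volume_Ioc]; exact ENNReal.ofReal_ne_top)
  calc ∫ a in Ioc (0 : ℝ) 1, G (a : UnitAddCircle) ≤ ∫ a in Ioc (0 : ℝ) 1, Z.indicator 1 a :=
        setIntegral_mono_on hint1 hint2 measurableSet_Ioc hle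
    _ = (volume.restrict (Ioc (0 : ℝ) 1)).real Z := integral_indicator_one hZm
    _ = volume.real (Z ∩ Ioc 0 1) := measureReal_restrict_apply hZm
    _ = volume.real {y : ℝ | y ∈ Ioc (0 : ℝ) 1 ∧ Xp y + Xm y < 1} := by
        congr 1; ext y; simp only [hZ_def, mem_inter_iff, mem_setOf_eq]; tauto

/-! ## The cascade: the cut-off zone lies in the corner neighbourhoods -/

/-- **Measure of the cut-off zone of the cascade profile.**  If the zone of the cut-offs lies in `{|U_j′| < 1 − ε}` with
`ε ≥ 2e^{−M²/2}` (`M ≥ 1`, `Mδ_j ≤ π/2`), then `vol{y ∈ (0,1] : X⁺ + X⁻ < 1} ≤ 4Mδ_j/π`.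
[cite: ElgindiLissMattingly2025, §1 (corner strips)] -/
theorem measureReal_cutoff_zone_le (P : CascadeParams) {j : ℕ} (hδ : 0 < P.δ j) (hN : P.N j ≠ 0) {M ε : ℝ} (hM : 1 ≤ M)
    (hMδ : M * P.δ j ≤ Real.pi / 2) (hε : 2 * Real.exp (-(M ^ 2 / 2)) ≤ ε) (Xp Xm : ShearProfile)
    (hzone : ∀ y, Xp y + Xm y < 1 → |deriv (P.U j) y| < 1 - ε) :
    volume.real {y : ℝ | y ∈ Ioc (0 : ℝ) 1 ∧ Xp y + Xm y < 1} ≤ 4 * M * P.δ j / Real.pi := by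
  set Zc : Set ℝ := {y : ℝ | y ∈ Ico (0 : ℝ) 1 ∧ 2 * Real.exp (-(M ^ 2 / 2)) < |deriv (P.U j) y - 1| ∧
      2 * Real.exp (-(M ^ 2 / 2)) < |deriv (P.U j) y + 1|} with hZc
  have hsub : {y : ℝ | y ∈ Ioc (0 : ℝ) 1 ∧ Xp y + Xm y < 1} ⊆ Zc ∪ {1} := by
    intro y hy
    obtain ⟨⟨hy0, hy1⟩, hX⟩ := hy
    have hV := hzone y hX
    have hexp : 0 < Real.exp (-(M ^ 2 / 2)) := Real.exp_pos _
    rw [abs_lt] at hV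
    have ha : 2 * Real.exp (-(M ^ 2 / 2)) < |deriv (P.U j) y - 1| := by
      rw [abs_sub_comm, abs_of_pos (by linarith)]; linarith
    have hb : 2 * Real.exp (-(M ^ 2 / 2)) < |deriv (P.U j) y + 1| := by
      rw [abs_of_pos (by linarith)]; linarith
    rcases hy1.lt_or_eq with hlt | heq
    · exact Or.inl ⟨⟨hy0.le, hlt⟩, ha, hb⟩
    · exact Or.inr heq
  have hvol := volume_zone_le' P hδ hN hM hMδ
  have hfin : volume Zc ≠ ∞ := ne_top_of_le_ne_top ENNReal.ofReal_ne_top hvol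
  have hpos : 0 ≤ 4 * M * P.δ j / Real.pi := by
    have := Real.pi_pos; positivity
  calc volume.real {y : ℝ | y ∈ Ioc (0 : ℝ) 1 ∧ Xp y + Xm y < 1}
      ≤ volume.real (Zc ∪ {1}) := measureReal_mono hsub (by
          rw [← lt_top_iff_ne_top]
          exact (measure_union_le _ _).trans_lt (by
            rw [Real.volume_singleton, add_zero]; exact lt_top_iff_ne_top.mpr hfin))
    _ ≤ volume.real Zc + volume.real ({1} : Set ℝ) := measureReal_union_le _ _
    _ = (volume Zc).toReal := by rw [measureReal_def, measureReal_def, Real.volume_singleton, ENNReal.toReal_zero, add_zero]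
    _ ≤ 4 * M * P.δ j / Real.pi := by
        rw [← ENNReal.toReal_ofReal hpos]
        exact ENNReal.toReal_mono ENNReal.ofReal_ne_top hvol

/-- **The zone-junk budget.**  Under the same hypotheses and `0 ≤ X⁺ + X⁻ ≤ 1`:
`∫_{𝕋^d} (1 − X⁺(x_j) − X⁻(x_j))² dx ≤ 4Mδ_j/π` — so the zone junk of a good piece bounded by `1` has energy `≤ 4Mδ_j/π`
(`…SlotRestart.junk_scalarL2Sq_le`). [cite: ElgindiLissMattingly2025, §1 (corner strips)] -/
theorem integral_one_sub_cutoff_sq_le (P : CascadeParams) {j : ℕ} (hδ : 0 < P.δ j) (hN : P.N j ≠ 0)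
    {M ε : ℝ} (hM : 1 ≤ M) (hMδ : M * P.δ j ≤ Real.pi / 2) (hε : 2 * Real.exp (-(M ^ 2 / 2)) ≤ ε)
    (Xp Xm : ShearProfile) (h0 : ∀ y, 0 ≤ Xp y + Xm y) (h1 : ∀ y, Xp y + Xm y ≤ 1)
    (hzone : ∀ y, Xp y + Xm y < 1 → |deriv (P.U j) y| < 1 - ε) (l : d) :
    ∫ x : UnitAddTorus d, (1 - Xp.onCircle (x l) - Xm.onCircle (x l)) ^ 2 ≤ 4 * M * P.δ j / Real.pi :=
  (integral_one_sub_sq_le_measureReal Xp Xm h0 h1 l).trans (measureReal_cutoff_zone_le P hδ hN hM hMδ hε Xp Xm hzone)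

end Summit.AnomalousDissipation.AnomalousDissipation.Theorems.SawtoothPulseCascade.K1Flat
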